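import Summits.KontsevichZagierPeriods.KontsevichZagierPeriods.Theorems.SymplecticScissorsPlanarK0InjectiveChainToPlanarAux

/-!
# `PlanarK0Injective` (stmt-KontsevichZagierPeriods-9847) — line `kernel-subgroup-homotopy`,
stub `stub_chainToPlanar`

CUBICAL IDENTITY ⇒ PLANAR IDENTITY (bookkeeping only). In the situation produced by the
null-homotopy stub — a literal identity `Σⱼ ∂[hⱼ] = Σᵢ εᵢ Σₗ [eᵢₗ] + Σ_q c_q [z_q]` in the free
abelian group on `ℚ`-semialgebraic `C¹` 1-cubes in `ℝᴺ`, a `ℚ`-semialgebraic `C¹` map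
`P : S → ℝᴺ` (the 1-form `Σ Pᵢ dxᵢ`), the density of `P` along `eᵢₗ` being the affinely rescaled
normalised density `fᵢ` on `[τᵢₗ, τᵢ,ₗ₊₁]` and the density along `z_q` vanishing — the signed sum of
the normalised cells `Σᵢ εᵢ [dᵢ]` is congruent, modulo the planar set-chain group `planarGroup`,
to the cubical signed sum `Σⱼ Σ_{k,e} (−1)^{k+e+1} ([ρⱼ k e +] − [ρⱼ k e −])` of integrand-`1`
representations of the positive / negative cells of the edge densities of the squares `hⱼ`.

Proof: attach to EVERY 1-cube `c` the formal difference `Ψ c = [R (cell⁺ c)] − [R (cell⁻ c)]` of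
canonically chosen integrand-`1` representations of its two edge cells (a function of the cube, so
that the free-abelian-group identity transfers through `FreeAbelianGroup.lift Ψ` with no case
analysis); the faces of the squares have `ℚ`-semialgebraic bounded densities (cells of finite
area); the cells of `z_q` and the negative cells of `eᵢₗ` are empty, hence null, hence `≡ 0`; the
positive cell of `eᵢₗ` is the image of the piece of `dᵢ` over `(τᵢₗ, τᵢ,ₗ₊₁)` under the affine map
`(x, y) ↦ ((x − τᵢₗ)/(τᵢ,ₗ₊₁ − τᵢₗ), (τᵢ,ₗ₊₁ − τᵢₗ) y)` of determinant `1` (one instance of rule 2),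
and `[dᵢ] ≡ Σₗ [pieceᵢₗ]` by finite cuts at the rational points `τᵢₗ` (rule 1a, null verticals).
The planar-set lemmas used (cells under bounded semialgebraic densities, rule 2 with `|det| = 1`,
the affine renormalisation of a piece, edge densities of cubes mapping into `S`) are in the helper
file `SymplecticScissorsPlanarK0InjectiveChainToPlanarAux.lean`.
[Kontsevich–Zagier 2001, §1.2; folklore]
-/

noncomputable section

open MeasureTheory Set Filter
open scoped Topology
open Literature.NumberTheory.Transcendental Literature.ModelTheory.ExponentialFields
open Summit.KontsevichZagierPeriods.SymplecticScissors.PlanarK0InjectiveNegative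
open Summit.KontsevichZagierPeriods.SymplecticScissors.PlanarCompilerProof

namespace Summit.KontsevichZagierPeriods.SymplecticScissors.KernelSubgroupHomotopy

/-! ## The stub -/

/-- **Stub 5 (cubical identity ⇒ planar identity).** In the situation produced by the
null-homotopy stub, for SOME choice of integrand-`1` representations `ρⱼ k e ±` of the positive /
negative cells of the four edge densities of each square `hⱼ`, the signed sum of the cells is
congruent modulo the planar set-chain group to the total signed edge sum
`Σⱼ Σ_{k,e} (−1)^{k+e+1} ([ρⱼ k e +] − [ρⱼ k e −])` (the cubical boundary signs). Bookkeeping only: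
choose the edge representations as a FUNCTION of the 1-cube (so literally equal faces get literally
equal representations and the free-abelian-group identity transfers), cut each cell `dᵢ` at the
rational points `τᵢₗ` (1a, null verticals), carry the piece over `(τᵢₗ, τᵢ,ₗ₊₁)` onto the positive
cell of the rescaled density by the affine map
`(x, y) ↦ ((x − τᵢₗ)/(τᵢ,ₗ₊₁ − τᵢₗ), (τᵢ,ₗ₊₁ − τᵢₗ) y)` (rule 2, `|det| = 1`), and note that the
cells of a zero density and the negative cells of the `eᵢₗ` are empty, hence null, hence `≡ 0`.
[Kontsevich–Zagier 2001, §1.2; folklore] -/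
theorem stub_chainToPlanar :
    ∀ (ι : Type) [Fintype ι] (f : ι → ℝ → ℝ) (ε : ι → ℤ) (δ : ι → ℝ) (d : ι → KZ.IntegralRep 2),
      (∀ i, 0 < δ i ∧
        IsSemialgebraicFunOn ℚ {z : Fin 1 → ℝ | z 0 ∈ Set.Ioo (0 : ℝ) 1} (fun z => f i (z 0)) ∧
        (∀ n : ℕ, ContDiffOn ℝ n (f i) (Set.Ioo (-δ i) (1 + δ i))) ∧
        (∀ x ∈ Set.Ioo (0 : ℝ) 1, 0 < f i x)) →
      (∀ i, ε i = 1 ∨ ε i = -1) →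
      (∀ i, (d i).domain = {p : Fin 2 → ℝ | p 0 ∈ Set.Ioo (0 : ℝ) 1 ∧ 0 < p 1 ∧ p 1 < f i (p 0)} ∧
        ∀ p ∈ (d i).domain, (d i).integrand p = 1) →
      ∀ (N : ℕ) (S : Set (Fin N → ℝ)) (P : (Fin N → ℝ) → (Fin N → ℝ)) (n : ℕ)
        (h : Fin n → NashCubeMap 2 N) (U : Set (Fin 2 → ℝ)) (L : ι → ℕ)
        (e : (i : ι) → Fin (L i) → NashCubeMap 1 N) (τ : (i : ι) → Fin (L i + 1) → ℚ) (m : ℕ)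
        (z : Fin m → NashCubeMap 1 N) (cz : Fin m → ℤ),
        IsOpen S → IsSemialgebraic ℚ S → IsSemialgebraicMapOn ℚ S P → ContDiffOn ℝ 1 P S →
        (∀ j, MapsTo (fun w => h j w) (closedUnitCube 2) S) → IsOpen U → closedUnitCube 2 ⊆ U →
        (∀ j, ∀ q : ℕ, ContDiffOn ℝ q (fun w => h j w) U) →
        (∀ i, τ i 0 = 0 ∧ τ i (Fin.last (L i)) = 1 ∧ StrictMono (τ i)) →
        (∀ i l, ∀ s ∈ Set.Icc (0 : ℝ) 1,
          (∑ i' : Fin N, P (e i l (fun _ => s)) i' *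
              fderiv ℝ (fun w => e i l w) (fun _ => s) (Pi.single 0 1) i') =
            ((τ i l.succ : ℝ) - τ i l.castSucc) *
              f i (τ i l.castSucc + ((τ i l.succ : ℝ) - τ i l.castSucc) * s)) →
        (∀ q, ∀ s ∈ Set.Icc (0 : ℝ) 1,
          (∑ i' : Fin N, P (z q (fun _ => s)) i' *
              fderiv ℝ (fun w => z q w) (fun _ => s) (Pi.single 0 1) i') = 0) →
        (∑ j, SemialgebraicCubicalChain.boundary (FreeAbelianGroup.of (h j)) =
          (∑ i, ε i • ∑ l, FreeAbelianGroup.of (e i l)) + ∑ q, cz q • FreeAbelianGroup.of (z q)) →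
        ∃ ρ : Fin n → Fin 2 → Fin 2 → Bool → KZ.IntegralRep 2,
          (∀ j k' e' b, ∀ p ∈ (ρ j k' e' b).domain, (ρ j k' e' b).integrand p = 1) ∧
          (∀ j k' e', (ρ j k' e' true).domain =
            {p : Fin 2 → ℝ | p 0 ∈ Set.Ioo (0 : ℝ) 1 ∧ 0 < p 1 ∧ p 1 <
              ∑ i' : Fin N, P ((h j).face k' e' (fun _ => p 0)) i' *
                fderiv ℝ (fun w => (h j).face k' e' w) (fun _ => p 0) (Pi.single 0 1) i'}) ∧
          (∀ j k' e', (ρ j k' e' false).domain =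
            {p : Fin 2 → ℝ | p 0 ∈ Set.Ioo (0 : ℝ) 1 ∧ 0 < p 1 ∧ p 1 <
              -(∑ i' : Fin N, P ((h j).face k' e' (fun _ => p 0)) i' *
                fderiv ℝ (fun w => (h j).face k' e' w) (fun _ => p 0) (Pi.single 0 1) i')}) ∧
          (∑ i, ε i • KZ.of (d i)) -
              ∑ j, ∑ k' : Fin 2, ∑ e' : Fin 2, ((-1 : ℤ) ^ (k'.val + e'.val + 1)) •
                (KZ.of (ρ j k' e' true) - KZ.of (ρ j k' e' false)) ∈ planarGroup := by
  intro ι _ f ε δ d hf _hε hd N S P n h U L e τ m z cz _hS hSsa hP hP1 hh _hU _hUc _hsm hτ he hz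
    hchain
  classical
  -- (0) notation: edge densities `D c`, cells, canonical integrand-`1` representations `R A`
  obtain ⟨D, hD⟩ : ∃ D : NashCubeMap 1 N → ℝ → ℝ, ∀ c s, D c s =
      ∑ i' : Fin N, P (c (fun _ => s)) i' *
        fderiv ℝ (fun w => c w) (fun _ => s) (Pi.single 0 1) i' := ⟨_, fun _ _ => rfl⟩
  obtain ⟨cell, hcell⟩ : ∃ cell : (ℝ → ℝ) → Set (Fin 2 → ℝ), ∀ g, cell g =
      {p : Fin 2 → ℝ | p 0 ∈ Set.Ioo (0 : ℝ) 1 ∧ 0 < p 1 ∧ p 1 < g (p 0)} := ⟨_, fun _ => rfl⟩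
  have hrep : ∀ A : Set (Fin 2 → ℝ), ∃ r : KZ.IntegralRep 2,
      (∀ p ∈ r.domain, r.integrand p = 1) ∧
        (IsSemialgebraic ℚ A → volume A ≠ ⊤ → r.domain = A) := by
    intro A
    by_cases hA : IsSemialgebraic ℚ A ∧ volume A ≠ ⊤
    · obtain ⟨r, hrd, hri⟩ := KZ.exists_oneRep hA.1 hA.2
      exact ⟨r, fun p _ => by rw [hri], fun _ _ => hrd⟩
    · obtain ⟨r, -, hri⟩ := KZ.exists_oneRep (n := 2) (isSemialgebraic_empty (k := ℚ)) (by simp)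
      exact ⟨r, fun p _ => by rw [hri], fun h1 h2 => (hA ⟨h1, h2⟩).elim⟩
  choose R hR1 hRd using hrep
  have hRnull : ∀ A, IsSemialgebraic ℚ A → volume A = 0 → KZ.of (R A) ∈ planarGroup :=
    fun A hA h0 => of_mem_planarGroup_of_volume_eq_zero (R A) (hR1 A)
      (by rw [hRd A hA (by rw [h0]; exact ENNReal.zero_ne_top)]; exact h0)
  obtain ⟨Ψ, hΨ⟩ : ∃ Ψ : NashCubeMap 1 N → KZ.FormalRep, ∀ c,
      Ψ c = KZ.of (R (cell (D c))) - KZ.of (R (cell (-D c))) := ⟨_, fun _ => rfl⟩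
  -- (1) push the cubical identity through `FreeAbelianGroup.lift Ψ`
  have hF : ∑ j, ∑ k' : Fin 2, ∑ e' : Fin 2, ((-1 : ℤ) ^ (k'.val + e'.val + 1)) •
      Ψ ((h j).face k' e') = (∑ i, ε i • ∑ l, Ψ (e i l)) + ∑ q, cz q • Ψ (z q) := by
    have := congrArg (FreeAbelianGroup.lift Ψ) hchain
    simpa only [map_add, map_sum, map_zsmul, SemialgebraicCubicalChain.boundary_of_eq_sum_sum,
      FreeAbelianGroup.lift_apply_of] using this
  -- (2) the edge cells of the faces of the squares are planar sets
  have hface : ∀ j k' e', IsSemialgebraic ℚ (cell (D ((h j).face k' e'))) ∧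
      volume (cell (D ((h j).face k' e'))) ≠ ⊤ ∧ IsSemialgebraic ℚ (cell (-D ((h j).face k' e'))) ∧
      volume (cell (-D ((h j).face k' e'))) ≠ ⊤ := by
    intro j k' e'
    obtain ⟨hsa, C, hC⟩ := chainToPlanar_dens_sa_bdd hSsa hP hP1.continuousOn ((h j).face k' e')
      (NashCubeMap.mapsTo_face (hh j) k' e')
    have hsa' : IsSemialgebraicFunOn ℚ {z : Fin 1 → ℝ | z 0 ∈ Set.Ioo (0 : ℝ) 1}
        (fun z => D ((h j).face k' e') (z 0)) := hsa.congr fun z _ => (hD _ (z 0)).symm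
    have hC' : ∀ s ∈ Set.Ioo (0 : ℝ) 1, |D ((h j).face k' e') s| ≤ C := fun s hs => by
      rw [hD]; exact hC s hs
    refine ⟨?_, ?_, ?_, ?_⟩
    · rw [hcell]; exact chainToPlanar_isSemialgebraic_cell hsa'
    · rw [hcell]
      exact chainToPlanar_volume_cell_ne_top fun s hs => (le_abs_self _).trans (hC' s hs)
    · rw [hcell]; exact chainToPlanar_isSemialgebraic_cell hsa'.neg
    · rw [hcell]
      exact chainToPlanar_volume_cell_ne_top fun s hs => (neg_le_abs _).trans (hC' s hs)
  -- (3) the cells of the zero-density cubes `z q` are empty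
  have hΨz : ∀ q, Ψ (z q) ∈ planarGroup := by
    intro q
    have hD0 : ∀ s ∈ Set.Ioo (0 : ℝ) 1, D (z q) s = 0 := fun s hs => by
      rw [hD]; exact hz q s (Ioo_subset_Icc_self hs)
    have h1 : cell (D (z q)) = ∅ := by
      rw [hcell]; ext p
      simp only [mem_setOf_eq, mem_empty_iff_false, iff_false]
      rintro ⟨h0, h1, h2⟩; rw [hD0 _ h0] at h2; linarith
    have h2 : cell (-D (z q)) = ∅ := by
      rw [hcell]; ext p
      simp only [mem_setOf_eq, mem_empty_iff_false, iff_false, Pi.neg_apply]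
      rintro ⟨h0, h1, h2⟩; rw [hD0 _ h0] at h2; linarith
    rw [hΨ]
    refine sub_mem (hRnull _ ?_ ?_) (hRnull _ ?_ ?_)
    · rw [h1]; exact isSemialgebraic_empty
    · rw [h1]; exact measure_empty
    · rw [h2]; exact isSemialgebraic_empty
    · rw [h2]; exact measure_empty
  -- (4) each cell `dᵢ` is, modulo `G`, the sum of the `Ψ (e i l)`
  have hΨe : ∀ i, KZ.of (d i) - ∑ l, Ψ (e i l) ∈ planarGroup := by
    intro i
    obtain ⟨hτ0, hτ1, hτm⟩ := hτ i
    have hτnn : ∀ l, (0 : ℝ) ≤ τ i l := fun l => by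
      have : τ i 0 ≤ τ i l := hτm.monotone (Fin.zero_le l)
      rw [hτ0] at this; exact_mod_cast this
    have hτle1 : ∀ l, (τ i l : ℝ) ≤ 1 := fun l => by
      have : τ i l ≤ τ i (Fin.last (L i)) := hτm.monotone (Fin.le_last l)
      rw [hτ1] at this; exact_mod_cast this
    have hΔ : ∀ l : Fin (L i), (τ i l.castSucc : ℝ) < τ i l.succ := fun l => by
      exact_mod_cast hτm (Fin.castSucc_lt_succ (i := l))
    -- the pieces of `dᵢ` over `(τᵢₗ, τᵢ,ₗ₊₁)`
    obtain ⟨Q, hQ⟩ : ∃ Q : Fin (L i) → Set (Fin 2 → ℝ), ∀ l,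
        Q l = (d i).domain ∩ {p | p 0 ∈ Set.Ioo (τ i l.castSucc : ℝ) (τ i l.succ)} :=
      ⟨_, fun _ => rfl⟩
    have hQsa : ∀ l, IsSemialgebraic ℚ (Q l) := fun l => by
      rw [hQ]; exact (d i).isSemialgebraic_domain.inter (isSemialgebraic_coord_Ioo 0 _ _)
    have hQsub : ∀ l, Q l ⊆ (d i).domain := fun l => by rw [hQ]; exact inter_subset_left
    have hpc : ∀ l, ∃ pc r' : KZ.IntegralRep 2, pc.domain = Q l ∧
        (∀ p ∈ pc.domain, pc.integrand p = 1) ∧ r'.domain = cell (D (e i l)) ∧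
        (∀ p ∈ r'.domain, r'.integrand p = 1) ∧ KZ.of pc - KZ.of r' ∈ planarGroup := by
      intro l
      have hpc1 : ∀ p ∈ ((d i).restrict (Q l) (hQsa l) (hQsub l)).domain,
          ((d i).restrict (Q l) (hQsa l) (hQsub l)).integrand p = 1 :=
        fun p hp => (hd i).2 p (hQsub l hp)
      have hpcd : ((d i).restrict (Q l) (hQsa l) (hQsub l)).domain =
          {p : Fin 2 → ℝ | p 0 ∈ Set.Ioo (τ i l.castSucc : ℝ) (τ i l.succ) ∧ 0 < p 1 ∧
            p 1 < f i (p 0)} := by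
        rw [KZ.IntegralRep.domain_restrict, hQ, (hd i).1]
        ext p
        simp only [mem_inter_iff, mem_setOf_eq]
        constructor
        · rintro ⟨⟨-, h1, h2⟩, h3⟩; exact ⟨h3, h1, h2⟩
        · rintro ⟨h3, h1, h2⟩
          exact ⟨⟨⟨(hτnn _).trans_lt h3.1, h3.2.trans_le (hτle1 _)⟩, h1, h2⟩, h3⟩
      obtain ⟨r', hr'd, hr'1, hcov⟩ :=
        chainToPlanar_affine_piece (hτm (Fin.castSucc_lt_succ (i := l))) _ hpcd hpc1
      refine ⟨_, r', rfl, hpc1, ?_, hr'1, hcov⟩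
      rw [hr'd, hcell]
      ext q
      simp only [mem_setOf_eq]
      constructor
      · rintro ⟨h0, h1, h2⟩
        refine ⟨h0, h1, ?_⟩
        rw [hD, he i l _ (Ioo_subset_Icc_self h0)]; exact h2
      · rintro ⟨h0, h1, h2⟩
        refine ⟨h0, h1, ?_⟩
        rw [hD, he i l _ (Ioo_subset_Icc_self h0)] at h2; exact h2
    choose pc r' hpcd hpc1 hr'd hr'1 hcov using hpc
    -- the negative cells of the `e i l` are empty
    have hneg : ∀ l, cell (-D (e i l)) = ∅ := by
      intro l
      rw [hcell]
      ext p
      simp only [mem_setOf_eq, mem_empty_iff_false, iff_false, Pi.neg_apply]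
      rintro ⟨h0, h1, h2⟩
      rw [hD, he i l _ (Ioo_subset_Icc_self h0)] at h2
      have hΔl := hΔ l
      have hx : (τ i l.castSucc : ℝ) + ((τ i l.succ : ℝ) - τ i l.castSucc) * p 0 ∈
          Set.Ioo (0 : ℝ) 1 := by
        constructor
        · have := mul_pos (sub_pos.2 hΔl) h0.1
          linarith [hτnn l.castSucc]
        · have := mul_lt_of_lt_one_right (sub_pos.2 hΔl) h0.2
          linarith [hτle1 l.succ]
      have hpos := mul_pos (sub_pos.2 hΔl) ((hf i).2.2.2 _ hx)
      linarith
    -- finite cuts of `dᵢ` at the rational points `τ i l`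
    have hcut : KZ.of (d i) - ∑ l, KZ.of (pc l) ∈ planarGroup := by
      refine of_sub_sum_mem_planarGroup Finset.univ (d i) (hd i).2 Q pc (fun l _ => hQsa l)
        (fun l _ => hQsub l) (fun l _ l' _ hll' => ?_) ?_ (fun l _ => hpcd l) (fun l _ => hpc1 l)
      · refine Set.disjoint_left.2 fun p hp hp' => hll' ?_
        rw [hQ] at hp hp'
        have h1 : p 0 ∈ Set.Ioo (τ i l.castSucc : ℝ) (τ i l.succ) := hp.2
        have h2 : p 0 ∈ Set.Ioo (τ i l'.castSucc : ℝ) (τ i l'.succ) := hp'.2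
        by_contra hne
        rcases lt_or_gt_of_ne hne with hlt | hlt
        · have hlt' : (l : ℕ) < l' := hlt
          have h3 : τ i l.succ ≤ τ i l'.castSucc := hτm.monotone (by
            rw [Fin.le_iff_val_le_val, Fin.val_succ, Fin.val_castSucc]; omega)
          have h4 : (τ i l.succ : ℝ) ≤ τ i l'.castSucc := by exact_mod_cast h3
          linarith [h1.2, h2.1]
        · have hlt' : (l' : ℕ) < l := hlt
          have h3 : τ i l'.succ ≤ τ i l.castSucc := hτm.monotone (by
            rw [Fin.le_iff_val_le_val, Fin.val_succ, Fin.val_castSucc]; omega)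
          have h4 : (τ i l'.succ : ℝ) ≤ τ i l.castSucc := by exact_mod_cast h3
          linarith [h1.1, h2.2]
      · -- the uncovered part lies on the finitely many (null) verticals `{x = τ i l}`
        have hvert : ∀ t : ℝ, volume {p : Fin 2 → ℝ | p 0 = t} = 0 := fun t => by
          rw [MeasureTheory.volume_pi]
          exact Measure.pi_hyperplane (fun _ : Fin 2 => (volume : Measure ℝ)) (0 : Fin 2) t
        refine measure_mono_null (fun p hp => ?_)
          (measure_iUnion_null fun l : Fin (L i + 1) => hvert (τ i l : ℝ))
        obtain ⟨hpd, hpU⟩ := hp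
        have hp0 : p 0 ∈ Set.Ioo (0 : ℝ) 1 := by rw [(hd i).1] at hpd; exact hpd.1
        simp only [mem_iUnion, mem_setOf_eq]
        by_contra hne
        push Not at hne
        have hnot : ∀ l : Fin (L i), ¬ (p 0 ∈ Set.Ioo (τ i l.castSucc : ℝ) (τ i l.succ)) :=
          fun l hl => hpU (mem_iUnion₂.2 ⟨l, Finset.mem_univ l, by rw [hQ]; exact ⟨hpd, hl⟩⟩)
        have hall : ∀ l : Fin (L i + 1), (τ i l : ℝ) < p 0 := by
          intro l
          induction l using Fin.induction with
          | zero => rw [hτ0]; exact_mod_cast hp0.1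
          | succ l ih =>
            rcases lt_trichotomy (τ i l.succ : ℝ) (p 0) with hlt | heq | hgt
            · exact hlt
            · exact absurd heq.symm (hne l.succ)
            · exact absurd ⟨ih, hgt⟩ (hnot l)
        have hlast := hall (Fin.last (L i))
        rw [hτ1] at hlast
        push_cast at hlast
        linarith [hp0.2]
    -- assemble
    have hl : ∀ l, KZ.of (pc l) - Ψ (e i l) ∈ planarGroup := by
      intro l
      have hsa : IsSemialgebraic ℚ (cell (D (e i l))) := by
        rw [← hr'd]; exact (r' l).isSemialgebraic_domain
      have hfin : volume (cell (D (e i l))) ≠ ⊤ := by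
        rw [← hr'd]; exact (volume_domain_lt_top_of_integrand_one (r' l) (hr'1 l)).ne
      have h1 : KZ.of (r' l) - KZ.of (R (cell (D (e i l)))) ∈ planarGroup :=
        of_sub_of_mem_planarGroup_of_domain_eq _ _ (hr'1 l) (hR1 _) (by rw [hRd _ hsa hfin, hr'd])
      have h2 : KZ.of (R (cell (-D (e i l)))) ∈ planarGroup :=
        hRnull _ (by rw [hneg]; exact isSemialgebraic_empty) (by rw [hneg]; exact measure_empty)
      have h3 : KZ.of (pc l) - Ψ (e i l) = (KZ.of (pc l) - KZ.of (r' l)) +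
          (KZ.of (r' l) - KZ.of (R (cell (D (e i l))))) + KZ.of (R (cell (-D (e i l)))) := by
        rw [hΨ]; abel
      rw [h3]
      exact add_mem (add_mem (hcov l) h1) h2
    have h4 : KZ.of (d i) - ∑ l, Ψ (e i l) =
        (KZ.of (d i) - ∑ l, KZ.of (pc l)) + ∑ l, (KZ.of (pc l) - Ψ (e i l)) := by
      rw [Finset.sum_sub_distrib]; abel
    rw [h4]
    exact add_mem hcut (sum_mem fun l _ => hl l)
  -- (5) the edge representations of the squares, and the conclusion
  obtain ⟨ρ, hρt, hρf⟩ : ∃ ρ : Fin n → Fin 2 → Fin 2 → Bool → KZ.IntegralRep 2,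
      (∀ j k' e', ρ j k' e' true = R (cell (D ((h j).face k' e')))) ∧
      (∀ j k' e', ρ j k' e' false = R (cell (-D ((h j).face k' e')))) :=
    ⟨fun j k' e' b => cond b (R (cell (D ((h j).face k' e')))) (R (cell (-D ((h j).face k' e')))),
      fun _ _ _ => rfl, fun _ _ _ => rfl⟩
  refine ⟨ρ, fun j k' e' b => ?_, fun j k' e' => ?_, fun j k' e' => ?_, ?_⟩
  · cases b
    · rw [hρf]; exact hR1 _
    · rw [hρt]; exact hR1 _
  · obtain ⟨h1, h2, -, -⟩ := hface j k' e'
    rw [hρt, hRd _ h1 h2, hcell]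
    simp only [hD]
  · obtain ⟨-, -, h1, h2⟩ := hface j k' e'
    rw [hρf, hRd _ h1 h2, hcell]
    simp only [Pi.neg_apply, hD]
  · simp only [hρt, hρf, ← hΨ]
    rw [hF]
    have hsplit : (∑ i, ε i • KZ.of (d i)) - ((∑ i, ε i • ∑ l, Ψ (e i l)) + ∑ q, cz q • Ψ (z q)) =
        ∑ i, ε i • (KZ.of (d i) - ∑ l, Ψ (e i l)) - ∑ q, cz q • Ψ (z q) := by
      simp only [smul_sub, Finset.sum_sub_distrib]; abel
    rw [hsplit]
    exact sub_mem (sum_mem fun i _ => AddSubgroup.zsmul_mem _ (hΨe i) _)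
      (sum_mem fun q _ => AddSubgroup.zsmul_mem _ (hΨz q) _)

end Summit.KontsevichZagierPeriods.SymplecticScissors.KernelSubgroupHomotopy

end
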